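import Summits.Ventures.PercRepro.GenQLargeGenB
import Summits.Ventures.PercRepro.GenQCoreChain

/-!
# PercRepro — TRACE LARGE AT EVERY LEVEL: the level-`(q + 1)` trace sums by counting, for every `q` (night-4, gen 7)

`TraceSumsCore q` asks, on every rank-`q` subset `H` of the core of a rank-`(q + 3)` Core matroid and every `t ≤ q`,
`0 ≤ Σ_{B ∈ R_q(H)} ((q + 3 − t)/(2 + m(B)) − ((q + 3)/(q + 2))·dem_t(H, B))`.  The summand is bounded below by
`LwT q f t |B| = (q + 3 − t)/(2 + μ(|B|)) − (q + 3)/(q + 2)` (`dem ≤ 1`, `m(B) ≤ μ(|B|)` by `mTr_le_muQ`), and the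
fibers `#{B ∈ R_q(H) : |B| = j}` are those of `GenQLargeGenB` — the same counting with the trace weight:
**`lbSumT_le_traceSum`**, `traceSum_nonneg_of_lbSumT`, and on the core (`sizeChain_core`)
`traceSum_nonneg_of_lbSumT_core`.  Thresholds (exact, `tools/lbsumt.py`; corank `d = |H| − q`): level `6` (`q = 5`,
`|H| ≤ 21`): `d ≥ 6 / 7 / 9 / 12` at `t = 1 … 4` (none at `t = 5`); level `7` (`q = 6`, `|H| ≤ 43`):
`d ≥ 11 / 12 / 14 / 17 / 20 / 35` at `t = 1 … 6`; level `8` (`q = 7`): `23 / 23 / 25 / 27 / 31 / 40 / 76`.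
`t = 0` is `traceSum_nonneg_of_t_zero` (every summand is `≥ 0`).  Imports `GenQLargeGenB`, `GenQCoreChain`.
-/
namespace PercRepro.Night4

open Finset ThmH SixFour GenQ PerFlat Star NightThree

variable {α : Type} [DecidableEq α] {M : Matroid α} [M.Finite]

/-- The trace summand of level `q + 1` at type `t`, as written in `TraceSumsCore`. -/
noncomputable def traceW (M : Matroid α) [M.Finite] (H : Finset α) (q t : ℕ) (B : Finset α) : ℚ :=
  (((q + 1 : ℕ) : ℚ) + 2 - t) * (1 / (2 + (mTr M B : ℚ))) -
    ((((q + 1 : ℕ) : ℚ) + 2) / (((q + 1 : ℕ) : ℚ) + 1)) * GenQ.dem M H t B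

/-- The lower trace weight at type `t` of a rank-`q` set with `j` points: `(q + 3 − t)/(2 + μ(j)) − (q + 3)/(q + 2)`. -/
def LwT (q : ℕ) (f : ℕ → ℕ) (t j : ℕ) : ℚ :=
  (((q + 1 : ℕ) : ℚ) + 2 - t) / (2 + (muQ q f j : ℚ)) - ((((q + 1 : ℕ) : ℚ) + 2) / (((q + 1 : ℕ) : ℚ) + 1))

/-- `0 ≤ dem ≤ 1`. -/
theorem dem_le_one (M : Matroid α) [M.Finite] (H : Finset α) (t : ℕ) (B : Finset α) : GenQ.dem M H t B ≤ 1 := by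
  unfold GenQ.dem
  split_ifs <;> norm_num

/-- The trace summand of `B ∈ R_q(H)` is `≥ LwT q f t |B|` (`t ≤ q + 3`). -/
theorem traceW_ge_LwT (hs : Simple M) {q : ℕ} {f : ℕ → ℕ} (hf : SizeChain M q f) (hq : 2 ≤ q) {H : Finset α}
    (hH : H ⊆ gr M) {t : ℕ} (ht : t ≤ q + 3) {B : Finset α} (hB : B ∈ Rq M H q) :
    LwT q f t B.card ≤ traceW M H q t B := by
  have hmu := mTr_le_muQ hs hf hq hH hB
  unfold LwT traceW
  have hnum : (0 : ℚ) ≤ ((q + 1 : ℕ) : ℚ) + 2 - t := by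
    have : (t : ℚ) ≤ (q : ℚ) + 3 := by exact_mod_cast ht
    push_cast
    linarith
  have hmu' : (mTr M B : ℚ) ≤ muQ q f B.card := by exact_mod_cast hmu
  have hpos : (0 : ℚ) < 2 + (mTr M B : ℚ) := by positivity
  have hdem := dem_le_one M H t B
  have hΦ : (0 : ℚ) ≤ (((q + 1 : ℕ) : ℚ) + 2) / (((q + 1 : ℕ) : ℚ) + 1) := by positivity
  have h1 : (((q + 1 : ℕ) : ℚ) + 2 - t) / (2 + (muQ q f B.card : ℚ)) ≤
      (((q + 1 : ℕ) : ℚ) + 2 - t) * (1 / (2 + (mTr M B : ℚ))) := by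
    rw [mul_one_div]
    gcongr
  have h2 : (((q + 1 : ℕ) : ℚ) + 2) / (((q + 1 : ℕ) : ℚ) + 1) * GenQ.dem M H t B ≤
      (((q + 1 : ℕ) : ℚ) + 2) / (((q + 1 : ℕ) : ℚ) + 1) := by
    calc (((q + 1 : ℕ) : ℚ) + 2) / (((q + 1 : ℕ) : ℚ) + 1) * GenQ.dem M H t B
        ≤ (((q + 1 : ℕ) : ℚ) + 2) / (((q + 1 : ℕ) : ℚ) + 1) * 1 := mul_le_mul_of_nonneg_left hdem hΦ
      _ = (((q + 1 : ℕ) : ℚ) + 2) / (((q + 1 : ℕ) : ℚ) + 1) := mul_one _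
  linarith

omit [DecidableEq α] in
/-- The sum of the lower trace weights, fiberwise by size. -/
theorem sum_LwT_eq_fibers (H : Finset α) (q : ℕ) (f : ℕ → ℕ) (t : ℕ) :
    ∑ B ∈ Rq M H q, LwT q f t B.card =
      ∑ j ∈ Finset.range (H.card + 1),
        (((Rq M H q).filter (fun B : Finset α => B.card = j)).card : ℚ) * LwT q f t j := by
  rw [← Finset.sum_fiberwise_of_maps_to (s := Rq M H q) (t := Finset.range (H.card + 1))
    (g := fun B : Finset α => B.card) (fun B hB => Finset.mem_coe.2 (Finset.mem_range.2
      (Nat.lt_succ_of_le (Finset.card_le_card (mem_Rq.1 hB).1))))]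
  apply Finset.sum_congr rfl
  intro j _
  rw [Finset.card_eq_sum_ones, Nat.cast_sum, Finset.sum_mul]
  apply Finset.sum_congr rfl
  intro B hB
  rw [(Finset.mem_filter.1 hB).2]
  push_cast
  ring

/-- The trace fiber bound at size `j`: as `gLBQ'` with the trace weight `LwT`. -/
def gLBT (q : ℕ) (f : ℕ → ℕ) (t n j : ℕ) : ℚ :=
  if j < q then 0
  else if f (q - 1) < j then (n.choose j : ℚ) * LwT q f t j
  else if f (q - 2) < j ∧ f (q - 2) + 1 ≤ min (n - 1) (f (q - 1)) ∧ 0 ≤ LwT q f t j then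
    max ((n.choose j : ℚ) - kapQ' q f n j * (n.choose (f (q - 2) + 1) : ℚ)) 0 * LwT q f t j
  else (n.choose j : ℚ) * min (LwT q f t j) 0

/-- The explicit trace bound `lbSumT q f t n = Σ_{j ≤ n} gLBT q f t n j`. -/
def lbSumT (q : ℕ) (f : ℕ → ℕ) (t n : ℕ) : ℚ := ∑ j ∈ Finset.range (n + 1), gLBT q f t n j

/-- The trace fiber bound: `gLBT q f t |H| j ≤ #{B ∈ R_q(H) : |B| = j}·LwT q f t j`. -/
theorem gLBT_le_fiber {q : ℕ} {f : ℕ → ℕ} (hf : SizeChain M q f) (hq : 2 ≤ q) {H : Finset α} (hH : H ⊆ gr M)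
    (hrH : M.eRk (H : Set α) = (q : ℕ∞)) (t j : ℕ) :
    gLBT q f t H.card j ≤ (((Rq M H q).filter (fun B : Finset α => B.card = j)).card : ℚ) * LwT q f t j := by
  unfold gLBT
  split_ifs with hjq hfj hmid
  · rw [card_filter_Rq_eq_zero_of_lt_gen (M := M) H hjq]
    simp
  · rw [card_filter_Rq_eq_choose_gen hf (by omega) hH hrH hfj]
  · obtain ⟨hj2, hkN, hL⟩ := hmid
    apply mul_le_mul_of_nonneg_right _ hL
    apply max_le
    · have hA := choose_le_card_filter_Rq_add_gen hf hq hH hrH hj2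
      have hB := sum_flats_choose_le_gen' hf hq hH hrH hj2
      have hpos : (0 : ℚ) < ((min (H.card - 1) (f (q - 1))).choose (f (q - 2) + 1) : ℚ) := by
        have : 0 < (min (H.card - 1) (f (q - 1))).choose (f (q - 2) + 1) := Nat.choose_pos hkN
        exact_mod_cast this
      have hA' : (H.card.choose j : ℚ) ≤ (((Rq M H q).filter (fun B : Finset α => B.card = j)).card : ℚ) +
          ((∑ F ∈ flatsQ M (q - 1), (F ∩ H).card.choose j : ℕ) : ℚ) := by exact_mod_cast hA
      have hB' : ((min (H.card - 1) (f (q - 1))).choose (f (q - 2) + 1) : ℚ) *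
          ((∑ F ∈ flatsQ M (q - 1), (F ∩ H).card.choose j : ℕ) : ℚ) ≤
          ((min (H.card - 1) (f (q - 1))).choose j : ℚ) * (H.card.choose (f (q - 2) + 1) : ℚ) := by
        exact_mod_cast hB
      have hB'' : ((∑ F ∈ flatsQ M (q - 1), (F ∩ H).card.choose j : ℕ) : ℚ) ≤
          kapQ' q f H.card j * (H.card.choose (f (q - 2) + 1) : ℚ) := by
        unfold kapQ'
        rw [div_mul_eq_mul_div, le_div_iff₀ hpos]
        linarith
      linarith
    · positivity
  · have hc : (((Rq M H q).filter (fun B : Finset α => B.card = j)).card : ℚ) ≤ (H.card.choose j : ℚ) := by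
      exact_mod_cast card_filter_Rq_le_choose_gen (M := M) H q j
    have hmin : min (LwT q f t j) 0 ≤ 0 := min_le_right _ _
    have hmin' : min (LwT q f t j) 0 ≤ LwT q f t j := min_le_left _ _
    have hf0 : (0 : ℚ) ≤ (((Rq M H q).filter (fun B : Finset α => B.card = j)).card : ℚ) := by positivity
    calc (H.card.choose j : ℚ) * min (LwT q f t j) 0
        ≤ (((Rq M H q).filter (fun B : Finset α => B.card = j)).card : ℚ) * min (LwT q f t j) 0 :=
          mul_le_mul_of_nonpos_right hc hmin
      _ ≤ (((Rq M H q).filter (fun B : Finset α => B.card = j)).card : ℚ) * LwT q f t j :=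
          mul_le_mul_of_nonneg_left hmin' hf0

/-- **TRACE LARGE AT EVERY LEVEL**: `lbSumT q f t |H| ≤ Σ_{B ∈ R_q(H)} traceW` on a rank-`q` set `H` of a simple
matroid with the size chain `f` (`t ≤ q + 3`). -/
theorem lbSumT_le_traceSum (hs : Simple M) {q : ℕ} {f : ℕ → ℕ} (hf : SizeChain M q f) (hq : 2 ≤ q) {H : Finset α}
    (hH : H ⊆ gr M) (hrH : M.eRk (H : Set α) = (q : ℕ∞)) {t : ℕ} (ht : t ≤ q + 3) :
    lbSumT q f t H.card ≤ ∑ B ∈ Rq M H q, traceW M H q t B := by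
  calc lbSumT q f t H.card = ∑ j ∈ Finset.range (H.card + 1), gLBT q f t H.card j := rfl
    _ ≤ ∑ j ∈ Finset.range (H.card + 1),
        (((Rq M H q).filter (fun B : Finset α => B.card = j)).card : ℚ) * LwT q f t j :=
        Finset.sum_le_sum (fun j _ => gLBT_le_fiber hf hq hH hrH t j)
    _ = ∑ B ∈ Rq M H q, LwT q f t B.card := (sum_LwT_eq_fibers H q f t).symm
    _ ≤ ∑ B ∈ Rq M H q, traceW M H q t B :=
        Finset.sum_le_sum (fun B hB => traceW_ge_LwT hs hf hq hH ht hB)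

/-- **The trace sums from the numerics**, in the form of `TraceSumsCore`: `0 ≤ lbSumT q f t |H|` gives
`0 ≤ Σ_{B ∈ R_q(H)} ((q + 3 − t)/(2 + m(B)) − ((q + 3)/(q + 2))·dem_t(H, B))`. -/
theorem traceSum_nonneg_of_lbSumT (hs : Simple M) {q : ℕ} {f : ℕ → ℕ} (hf : SizeChain M q f) (hq : 2 ≤ q)
    {H : Finset α} (hH : H ⊆ gr M) (hrH : M.eRk (H : Set α) = (q : ℕ∞)) {t : ℕ} (ht : t ≤ q + 3)
    (hnum : 0 ≤ lbSumT q f t H.card) :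
    0 ≤ ∑ B ∈ Rq M H q, ((((q + 1 : ℕ) : ℚ) + 2 - t) * (1 / (2 + (mTr M B : ℚ))) -
      ((((q + 1 : ℕ) : ℚ) + 2) / (((q + 1 : ℕ) : ℚ) + 1)) * GenQ.dem M H t B) :=
  hnum.trans (lbSumT_le_traceSum hs hf hq hH hrH ht)

/-- **TRACE LARGE ON THE CORE AT EVERY LEVEL** (`Core M p`, `f(4) ≤ 10`): from `0 ≤ lbSumT q fCore t |H|`. -/
theorem traceSum_nonneg_of_lbSumT_core {p : ℕ} (hc : Core M p) (h10 : ∀ F ∈ flatsQ M 4, F.card ≤ 10) {q : ℕ}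
    (hq : 2 ≤ q) {H : Finset α} (hH : H ⊆ gr M) (hrH : M.eRk (H : Set α) = (q : ℕ∞)) {t : ℕ} (ht : t ≤ q + 3)
    (hnum : 0 ≤ lbSumT q fCore t H.card) :
    0 ≤ ∑ B ∈ Rq M H q, ((((q + 1 : ℕ) : ℚ) + 2 - t) * (1 / (2 + (mTr M B : ℚ))) -
      ((((q + 1 : ℕ) : ℚ) + 2) / (((q + 1 : ℕ) : ℚ) + 1)) * GenQ.dem M H t B) :=
  traceSum_nonneg_of_lbSumT (simple_of_core hc) (sizeChain_core hc h10 q) hq hH hrH ht hnum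

/-- At type `0` every trace summand is `≥ 0` (`m(B) ≤ q`): the trace sum is `≥ 0` outright. -/
theorem traceSum_nonneg_of_t_zero {q : ℕ} {H : Finset α} (hH : H ⊆ gr M) :
    0 ≤ ∑ B ∈ Rq M H q, ((((q + 1 : ℕ) : ℚ) + 2 - (0 : ℕ)) * (1 / (2 + (mTr M B : ℚ))) -
      ((((q + 1 : ℕ) : ℚ) + 2) / (((q + 1 : ℕ) : ℚ) + 1)) * GenQ.dem M H 0 B) := by
  apply Finset.sum_nonneg
  intro B hB
  have hB' := mem_Rq.1 hB
  have hm : mTr M B ≤ q := mTr_le_of_eRk_eq (hB'.1.trans hH) hB'.2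
  have hm' : (mTr M B : ℚ) ≤ q := by exact_mod_cast hm
  have hdem := dem_le_one M H 0 B
  have hq3 : (0 : ℚ) < ((q + 1 : ℕ) : ℚ) + 2 := by positivity
  have hpos : (0 : ℚ) < 2 + (mTr M B : ℚ) := by positivity
  have hpos' : (0 : ℚ) < ((q + 1 : ℕ) : ℚ) + 1 := by positivity
  have h1 : (((q + 1 : ℕ) : ℚ) + 2) / (((q + 1 : ℕ) : ℚ) + 1) ≤ (((q + 1 : ℕ) : ℚ) + 2) * (1 / (2 + (mTr M B : ℚ))) := by
    rw [mul_one_div]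
    apply div_le_div_of_nonneg_left hq3.le hpos
    push_cast
    linarith
  have hΦ : (0 : ℚ) ≤ (((q + 1 : ℕ) : ℚ) + 2) / (((q + 1 : ℕ) : ℚ) + 1) := by positivity
  have h2 : (((q + 1 : ℕ) : ℚ) + 2) / (((q + 1 : ℕ) : ℚ) + 1) * GenQ.dem M H 0 B ≤
      (((q + 1 : ℕ) : ℚ) + 2) / (((q + 1 : ℕ) : ℚ) + 1) := by
    calc (((q + 1 : ℕ) : ℚ) + 2) / (((q + 1 : ℕ) : ℚ) + 1) * GenQ.dem M H 0 B
        ≤ (((q + 1 : ℕ) : ℚ) + 2) / (((q + 1 : ℕ) : ℚ) + 1) * 1 := mul_le_mul_of_nonneg_left hdem hΦ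
      _ = _ := mul_one _
  simp only [Nat.cast_zero, sub_zero]
  linarith

end PercRepro.Night4
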